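import Mathlib.RingTheory.Invariant.Profinite
import Mathlib.RingTheory.Ideal.Pointwise
import Mathlib.RingTheory.Ideal.Over
import HarnessLib

/-!
# Lifting inertia through a closed subgroup of a profinite group

Let a profinite group `Γ` act continuously on a discrete commutative ring `B`, let `N ≤ Γ` be a
closed subgroup, `B^N ⊆ B` its ring of invariants and `𝔓 ⊂ B` a prime ideal. If `g ∈ Γ` acts
*as an element of inertia on the invariants*, i.e. `g • b - b ∈ 𝔓` for every `N`-fixed `b`
(for `N ⊴ Γ` this says: the image of `g` in `Γ/N` lies in the inertia group of the prime
`𝔓 ∩ B^N` of `B^N`), then `g` can be corrected on both sides by elements of `N` into the inertia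
group `I_𝔓(Γ) = {σ | ∀ b, σ • b - b ∈ 𝔓}` of `𝔓` itself (`Literature.NumberTheory.GaloisRepresentations.exists_mul_mul_mem_inertia`).

For `Γ = Gal(K̄/k)`, `N = Gal(K̄/L)` with `L/k` finite Galois and `B` the ring of algebraic
integers, this is the classical statement that the inertia group of a prime `𝔓` of `K̄`
*surjects* onto the inertia group `I(𝔓 ∩ L ∣ 𝔓 ∩ k) ≤ Gal(L/k)` at the finite level
(Serre, *Local Fields*, Ch. I §7, Prop. 22(b): for `E/K` Galois the rows and columns of the
diagram `1 → T(L/E) → T(L/K) → T(E/K) → 1` of inertia groups are exact; Neukirch, *Algebraic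
Number Theory*, Ch. I §9 (9.4)–(9.6) and Ch. II §9 (9.4)–(9.5) for the functoriality of
decomposition and inertia groups, also for infinite Galois extensions). It is the input needed to compare "unramified" in the sense of the absolute
inertia groups `I_𝔓 ≤ Gal(K̄/k)` (Silverman, *AEC*, VIII.§2, X.§4) with ramification indices of
finite extensions.

Proof (the standard one, run with Mathlib's profinite Frobenius machinery for the group `N`
acting on `B` with invariant ring `B^N`, `Mathlib/RingTheory/Invariant/Profinite.lean`):
`g⁻¹ • 𝔓` and `𝔓` contract to the same prime of `B^N`, so by transitivity of `N` on the primes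
above it (`Algebra.IsInvariant.exists_smul_of_under_eq_of_profinite`) some `g * n₁` stabilises
`𝔓`; it then induces a `B^N/(𝔓 ∩ B^N)`-algebra automorphism of `B/𝔓`, which by
`Ideal.Quotient.stabilizerHom_surjective_of_profinite` is also induced by some `n₂ ∈ N`
stabilising `𝔓`; and `n₂⁻¹ * g * n₁` acts trivially on `B/𝔓`.

## Mathlib reuse

`FixedPoints.subring`, `Algebra.IsInvariant`, `Algebra.IsInvariant.exists_smul_of_under_eq_of_profinite`,
`Ideal.Quotient.stabilizerHom(_surjective_of_profinite)`, `Ideal.quotientEquiv`,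
`Ideal.pointwiseMulSemiringAction`, `Ideal.inertia`, `AddSubgroup.mem_inertia`.
-/

noncomputable section

open scoped Pointwise

universe u

namespace Literature.NumberTheory.GaloisRepresentations

variable {B : Type*} [CommRing B] {Γ : Type u} [Group Γ] [MulSemiringAction Γ B]

/-- The action of a subgroup `N` on `B` has ring of invariants the fixed-point subring `B^N`
(the tautological case of Mathlib's `Algebra.IsInvariant`, needed to run the Frobenius machinery
of `Mathlib/RingTheory/Invariant` for `N`). Neukirch, *Algebraic Number Theory*, Ch. I §9. [folklore] -/
theorem isInvariant_fixedPointsSubring (N : Subgroup Γ) :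
    Algebra.IsInvariant (FixedPoints.subring B N) B N :=
  ⟨fun b hb ↦ ⟨⟨b, hb⟩, rfl⟩⟩

variable [TopologicalSpace Γ] [CompactSpace Γ] [TotallyDisconnectedSpace Γ] [IsTopologicalGroup Γ]
  [TopologicalSpace B] [DiscreteTopology B] [ContinuousSMul Γ B]

/-- **Lifting inertia through a closed subgroup.** Let the profinite group `Γ` act continuously
on the discrete commutative ring `B`, let `N ≤ Γ` be closed and `𝔓 ⊂ B` prime. If `g ∈ Γ`
satisfies `g • b - b ∈ 𝔓` for every `N`-invariant `b ∈ B` (i.e. `g` induces an element of the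
inertia group of `𝔓 ∩ B^N` at the level of `B^N`), then `n * g * n' ∈ I_𝔓(Γ)` for some
`n, n' ∈ N`. Equivalently: the inertia group `I_𝔓(Γ)` surjects onto the inertia group at the level
of the invariants of `N`. Serre, *Local Fields*, Ch. I §7, Prop. 22(b) (exactness of
`T(L/K) → T(E/K) → 1` for a Galois subextension `E/K`); Neukirch, *Algebraic Number Theory*,
Ch. I §9 (9.4)–(9.6) and Ch. II §9 (9.4)–(9.5) (functoriality of decomposition and inertia groups,
infinite extensions included). [cite: SerreLocalFields1979, Ch. I §7 Prop. 22(b)] -/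
theorem exists_mul_mul_mem_inertia (N : Subgroup Γ) (hN : IsClosed (N : Set Γ))
    (𝔓 : Ideal B) [𝔓.IsPrime] (g : Γ)
    (hg : ∀ b : B, (∀ n ∈ N, n • b = b) → g • b - b ∈ 𝔓) :
    ∃ n ∈ N, ∃ n' ∈ N, n * g * n' ∈ 𝔓.inertia Γ := by
  classical
  -- the ring of `N`-invariants and the profinite structure on `N`
  let A : Subring B := FixedPoints.subring B N
  haveI : Algebra.IsInvariant A B N := isInvariant_fixedPointsSubring N
  haveI : CompactSpace N := isCompact_iff_compactSpace.mp hN.isCompact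
  have hfix : ∀ a : A, ∀ n ∈ N, n • (a : B) = a := fun a n hn ↦ a.2 ⟨n, hn⟩
  -- Step 1: `g⁻¹ • 𝔓` and `𝔓` lie over the same prime of `A`, so `g * n₁ ∈ D_𝔓` for some `n₁ ∈ N`.
  have hunder : 𝔓.under A = (g⁻¹ • 𝔓).under A := by
    ext a
    simp only [Ideal.under, Ideal.mem_comap]
    rw [Ideal.mem_inv_pointwise_smul_iff]
    change (a : B) ∈ 𝔓 ↔ g • (a : B) ∈ 𝔓
    have hga : g • (a : B) - a ∈ 𝔓 := hg a (hfix a)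
    constructor
    · intro h
      simpa using 𝔓.add_mem hga h
    · intro h
      simpa using 𝔓.sub_mem h hga
  obtain ⟨n₁, hn₁⟩ :=
    Algebra.IsInvariant.exists_smul_of_under_eq_of_profinite (A := A) (G := N) 𝔓 (g⁻¹ • 𝔓) hunder
  -- `hn₁ : g⁻¹ • 𝔓 = n₁ • 𝔓`
  have hn₁' : (g⁻¹ • 𝔓 : Ideal B) = ((n₁ : Γ) • 𝔓 : Ideal B) := hn₁
  set g₁ : Γ := g * (n₁ : Γ) with hg₁def
  have hg₁ : g₁ • 𝔓 = 𝔓 := by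
    rw [hg₁def, mul_smul, ← hn₁', smul_inv_smul]
  have hg₁fix : ∀ a : A, g₁ • (a : B) - a ∈ 𝔓 := by
    intro a
    rw [hg₁def, mul_smul, hfix a _ n₁.2]
    exact hg a (hfix a)
  -- Step 2: the automorphism of `B ⧸ 𝔓` induced by `g₁` is `A ⧸ (𝔓 ∩ A)`-linear.
  let e : B ≃+* B := MulSemiringAction.toRingEquiv Γ B g₁
  have he : 𝔓 = 𝔓.map (e : B →+* B) := by
    rw [Ideal.map_comap_of_equiv]
    ext x
    rw [Ideal.mem_comap]
    change x ∈ 𝔓 ↔ g₁⁻¹ • x ∈ 𝔓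
    rw [← Ideal.mem_pointwise_smul_iff_inv_smul_mem, hg₁]
  let θ₀ : B ⧸ 𝔓 ≃+* B ⧸ 𝔓 := Ideal.quotientEquiv 𝔓 𝔓 e he
  have hθ₀ : ∀ b : B, θ₀ (Ideal.Quotient.mk 𝔓 b) = Ideal.Quotient.mk 𝔓 (g₁ • b) := fun b ↦
    Ideal.quotientEquiv_mk 𝔓 𝔓 e he b
  let θ : (B ⧸ 𝔓) ≃ₐ[A ⧸ 𝔓.under A] (B ⧸ 𝔓) :=
    { θ₀ with
      commutes' := by
        intro r
        obtain ⟨a, rfl⟩ := Ideal.Quotient.mk_surjective r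
        rw [Ideal.Quotient.algebraMap_mk_of_liesOver]
        change θ₀ (Ideal.Quotient.mk 𝔓 (a : B)) = Ideal.Quotient.mk 𝔓 (a : B)
        rw [hθ₀, Ideal.Quotient.eq]
        exact hg₁fix a }
  have hθ : ∀ b : B, θ (Ideal.Quotient.mk 𝔓 b) = Ideal.Quotient.mk 𝔓 (g₁ • b) := hθ₀
  -- Step 3: by surjectivity of `D_𝔓(N) → Aut((B ⧸ 𝔓)/(A ⧸ 𝔓 ∩ A))`, `θ` is induced by some `n₂ ∈ N`.
  obtain ⟨n₂, hn₂⟩ :=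
    Ideal.Quotient.stabilizerHom_surjective_of_profinite (G := N) (𝔓.under A) 𝔓 θ
  have hn₂b : ∀ b : B, g₁ • b - ((n₂ : N) : Γ) • b ∈ 𝔓 := by
    intro b
    rw [← Ideal.Quotient.eq, ← hθ b]
    have := DFunLike.congr_fun hn₂ (Ideal.Quotient.mk 𝔓 b)
    rw [Ideal.Quotient.stabilizerHom_apply] at this
    exact this.symm
  have hn₂stab : ((n₂ : N) : Γ) • 𝔓 = 𝔓 := n₂.2
  -- Step 4: `n₂⁻¹ * g * n₁` lies in the inertia group of `𝔓`.
  refine ⟨((n₂ : N) : Γ)⁻¹, N.inv_mem (n₂ : N).2, (n₁ : Γ), n₁.2, ?_⟩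
  rw [Ideal.inertia, AddSubgroup.mem_inertia]
  intro b
  have hinv : ((n₂ : N) : Γ)⁻¹ • 𝔓 = 𝔓 := by
    rw [inv_smul_eq_iff, hn₂stab]
  have h1 : ((n₂ : N) : Γ)⁻¹ • (g₁ • b - ((n₂ : N) : Γ) • b) ∈ ((n₂ : N) : Γ)⁻¹ • 𝔓 :=
    Ideal.smul_mem_pointwise_smul _ _ _ (hn₂b b)
  rw [hinv, smul_sub, inv_smul_smul] at h1
  simpa [hg₁def, mul_smul, mul_assoc] using h1

end Literature.NumberTheory.GaloisRepresentations
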